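import Summits.AnomalousDissipation.AnomalousDissipation.Theorems.SawtoothPulseCascadeK2ParallelShear
import Literature.Analysis.FluidPDE.SawtoothCascadeSmooth

/-!
# The parallel half-pulse rung of K2″ in classical typing: an injection parallel to the running pulse
# is carried through that half pulse as a pure heat flow, unamplified
(route `AnomalousDissipation/SawtoothPulseCascade`, crux `K2LinearisedCascadeGrowth`,
stmt-AnomalousDissipation-20025; helper — §2 of `SawtoothPulseCascadeK2ParallelShear`)

On the H half-slot `[tStart j, tStart j + tHalf j]` of phase `j` the cascade carrier is the horizontal
shear `ū = rateH_j(t) U_j(x₂) e₁` (`CascadeParams.field_eq_of_mem_H`), on the V half-slot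
`[tStart j + tHalf j, tStart (j+1)]` the vertical shear `rateV_j(t) U_j(x₁) e₂`.  Specialising §1
(`K2Classical.linearisedNS_parallelShear`, `K2Classical.vectorL2Sq_parallelShear_le`) and the tree's
uniqueness theorem `Torus.linearisedNS_unique`:

* `linearisedNS_parallel_H` / `_V`: for every heat profile `h` on the slot (jointly smooth, `1`-periodic,
  `∂ₜ|_slot h = ν ∂²_y h`) the parallel field `h(t, x₂) e₁` (resp. `h(t, x₁) e₂`) is a classical solution of
  the Navier–Stokes equations linearised at the cascade carrier on that slot, with pressure `0`;
* `vectorL2Sq_parallel_H_le` / `_V_le`: its energy is non-increasing on the slot (`ν ≥ 0`);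
* `parallel_H_unique` / `parallel_V_unique`: EVERY classical linearised solution `(w, q)` on the slot whose
  datum is the parallel profile `h(slot start, ·)` coincides with the parallel heat field, hence
  `‖w(t)‖²_{L²} ≤ ‖w(slot start)‖²_{L²}` — the CLASSICAL form of the registered BC5 rung
  `stub_rung_parallelHalfPulse` of K2″ (factor `1 ≤ 3e^{σ⋆γ}` on the parallel half pulse), modulo the
  heat profile `h` from the datum, which the consumer supplies (for residual-comb data
  `ShearCombDatum`: the explicit Fourier series `Σ aₙ e^{−4π²ν n²(t−t₀)} e^{2πi n y}`).

Hypotheses on the parameter point: `δ₀ > 0`, `d > 0` (smooth profiles, jointly smooth carrier by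
`cascadeFieldSmooth`); no sign condition on `γ`.
-/

-- `Summit.<Summit>.<Problem>` is the tree's mandated summit-side namespace (CONVENTIONS §2); for this
-- single-conjunct summit the two coincide, so the duplicate is deliberate (lakefile: off for `Summits`).
set_option linter.dupNamespace false

noncomputable section

namespace Summit.AnomalousDissipation.AnomalousDissipation.Theorems.SawtoothPulseCascade.K2Classical

open Set MeasureTheory
open scoped InnerProductSpace ContDiff
open Literature.Analysis Literature.Analysis.FunctionSpaces Literature.Analysis.FluidPDE
open Literature.Analysis.FluidPDE.SawtoothCascade
open Literature.Analysis.FluidPDE.SawtoothCascade.CascadeParams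

/-! ## The H half-slot -/

/-- On the H half-slot of phase `j` the cascade field is the shear `x ↦ (rateH_j(t) U_j(x₂)) e₁`. -/
theorem field_eq_parallel_H (P : CascadeParams) {j : ℕ} {t : ℝ}
    (ht : t ∈ Icc (tStart j) (tStart j + tHalf j)) :
    P.field t = fun y => (P.rateH j t * P.U j (Torus.repr y 1)) • EuclideanSpace.single (0 : Fin 2) (1 : ℝ) := by
  funext y
  rw [P.field_eq_of_mem_H ht y]
  ext i
  fin_cases i <;> simp

/-- **Parallel heat profiles solve the linearised equations on the H half-slot.** For `δ₀ > 0`, `d > 0` and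
a heat profile `h` on `[tStart j, tStart j + tHalf j]` (jointly smooth, `1`-periodic in space,
`∂ₜ|_slot h = ν ∂²_y h`), the horizontal parallel field `W(t, x) = h(t, x₂) e₁` satisfies
`∂ₜ|_slot W + (ū·∇)W + (W·∇)ū = νΔW − ∇0` along the cascade carrier `ū` on the slot. -/
theorem linearisedNS_parallel_H (P : CascadeParams) (hδ₀ : 0 < P.δ₀) (hd : 0 < P.d) {j : ℕ} {ν : ℝ}
    {h : ℝ → ℝ → ℝ}
    (hh : ContDiffOn ℝ ∞ (Function.uncurry h) (Icc (tStart j) (tStart j + tHalf j) ×ˢ univ))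
    (hper : ∀ t ∈ Icc (tStart j) (tStart j + tHalf j), Function.Periodic (h t) 1)
    (heat : ∀ t ∈ Icc (tStart j) (tStart j + tHalf j), ∀ y,
      derivWithin (fun τ => h τ y) (Icc (tStart j) (tStart j + tHalf j)) t = ν * deriv (deriv (h t)) y) :
    ∀ t ∈ Icc (tStart j) (tStart j + tHalf j), ∀ x,
      Torus.timeDerivWithin (Icc (tStart j) (tStart j + tHalf j))
          (fun τ (y : UnitAddTorus (Fin 2)) => h τ (Torus.repr y 1) • EuclideanSpace.single (0 : Fin 2) (1 : ℝ)) t x +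
        Torus.convect (P.field t) (fun y => h t (Torus.repr y 1) • EuclideanSpace.single (0 : Fin 2) (1 : ℝ)) x +
        Torus.convect (fun y => h t (Torus.repr y 1) • EuclideanSpace.single (0 : Fin 2) (1 : ℝ)) (P.field t) x =
      ν • Torus.laplacian (fun y => h t (Torus.repr y 1) • EuclideanSpace.single (0 : Fin 2) (1 : ℝ)) x -
        Torus.gradient (fun _ : UnitAddTorus (Fin 2) => (0 : ℝ)) x :=
  linearisedNS_parallelShear (k := 1) (m := 0) (by decide)
    (uniqueDiffOn_Icc (by linarith [tHalf_pos j])) (u := P.field)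
    (c := fun t y => P.rateH j t * P.U j y) (fun _ ht => field_eq_parallel_H P ht)
    (fun t _ y => by simp only [P.U_periodic j y])
    (fun _ _ => contDiff_const.mul (P.contDiff_U (P.δ_pos hδ₀ hd j))) hh hper heat

/-- **Parallel heat profiles are not amplified by the H pulse**: with `ν ≥ 0`, the energy of
`W(t) = h(t, x₂) e₁` is non-increasing on the H half-slot, `‖W(t)‖²_{L²} ≤ ‖W(tStart j)‖²_{L²}`. -/
theorem vectorL2Sq_parallel_H_le (P : CascadeParams) (hδ₀ : 0 < P.δ₀) (hd : 0 < P.d) {j : ℕ}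
    {ν : ℝ} (hν : 0 ≤ ν) {h : ℝ → ℝ → ℝ}
    (hh : ContDiffOn ℝ ∞ (Function.uncurry h) (Icc (tStart j) (tStart j + tHalf j) ×ˢ univ))
    (hper : ∀ t ∈ Icc (tStart j) (tStart j + tHalf j), Function.Periodic (h t) 1)
    (heat : ∀ t ∈ Icc (tStart j) (tStart j + tHalf j), ∀ y,
      derivWithin (fun τ => h τ y) (Icc (tStart j) (tStart j + tHalf j)) t = ν * deriv (deriv (h t)) y)
    {t : ℝ} (ht : t ∈ Icc (tStart j) (tStart j + tHalf j)) :
    Torus.vectorL2Sq (fun y : UnitAddTorus (Fin 2) => h t (Torus.repr y 1) • EuclideanSpace.single (0 : Fin 2) (1 : ℝ)) ≤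
      Torus.vectorL2Sq
        (fun y : UnitAddTorus (Fin 2) => h (tStart j) (Torus.repr y 1) • EuclideanSpace.single (0 : Fin 2) (1 : ℝ)) := by
  have hF : Torus.IsSmoothSpaceTimeOn (Ico 0 1) P.field := cascadeFieldSmooth P hδ₀ hd
  have hfield : Torus.IsSmoothSpaceTimeOn (Icc (tStart j) (tStart j + tHalf j)) P.field :=
    hF.mono fun s hs => ⟨(tStart_nonneg j).trans hs.1, lt_of_le_of_lt hs.2 (tStart_add_tHalf_lt_one j)⟩
  exact vectorL2Sq_parallelShear_le (k := 1) (m := 0) (by decide) (by linarith [tHalf_pos j]) hν hfield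
    (fun s hs => P.isDivFree_field_of_mem_H hs) (c := fun t y => P.rateH j t * P.U j y)
    (fun _ hs => field_eq_parallel_H P hs) (fun t _ y => by simp only [P.U_periodic j y])
    (fun _ _ => contDiff_const.mul (P.contDiff_U (P.δ_pos hδ₀ hd j))) hh hper heat ht

/-- **The classical parallel half-pulse rung, H half.** Every classical solution `(w, q)` of the
Navier–Stokes equations linearised at the cascade carrier on the H half-slot of phase `j` whose datum is
a horizontal parallel profile, `w(tStart j) = h(tStart j, x₂) e₁` for a heat profile `h` on the slot
(`ν ≥ 0`), IS the parallel heat field — `w(t) = h(t, x₂) e₁` (tree uniqueness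
`Torus.linearisedNS_unique`) — and is therefore not amplified: `‖w(t)‖²_{L²} ≤ ‖w(tStart j)‖²_{L²}`. -/
theorem parallel_H_unique (P : CascadeParams) (hδ₀ : 0 < P.δ₀) (hd : 0 < P.d) {j : ℕ} {ν : ℝ}
    (hν : 0 ≤ ν) {h : ℝ → ℝ → ℝ}
    (hh : ContDiffOn ℝ ∞ (Function.uncurry h) (Icc (tStart j) (tStart j + tHalf j) ×ˢ univ))
    (hper : ∀ t ∈ Icc (tStart j) (tStart j + tHalf j), Function.Periodic (h t) 1)
    (heat : ∀ t ∈ Icc (tStart j) (tStart j + tHalf j), ∀ y,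
      derivWithin (fun τ => h τ y) (Icc (tStart j) (tStart j + tHalf j)) t = ν * deriv (deriv (h t)) y)
    {w : ℝ → UnitAddTorus (Fin 2) → EuclideanSpace ℝ (Fin 2)} {q : ℝ → UnitAddTorus (Fin 2) → ℝ}
    (hw : Torus.IsSmoothSpaceTimeOn (Icc (tStart j) (tStart j + tHalf j)) w)
    (hq : Torus.IsSmoothSpaceTimeOn (Icc (tStart j) (tStart j + tHalf j)) q)
    (hwdiv : ∀ t ∈ Icc (tStart j) (tStart j + tHalf j), Torus.IsDivFree (w t))
    (hlin : ∀ t ∈ Icc (tStart j) (tStart j + tHalf j), ∀ x,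
      Torus.timeDerivWithin (Icc (tStart j) (tStart j + tHalf j)) w t x + Torus.convect (P.field t) (w t) x +
        Torus.convect (w t) (P.field t) x = ν • Torus.laplacian (w t) x - Torus.gradient (q t) x)
    (h0 : w (tStart j) =
      fun y => h (tStart j) (Torus.repr y 1) • EuclideanSpace.single (0 : Fin 2) (1 : ℝ))
    {t : ℝ} (ht : t ∈ Icc (tStart j) (tStart j + tHalf j)) :
    w t = (fun y => h t (Torus.repr y 1) • EuclideanSpace.single (0 : Fin 2) (1 : ℝ)) ∧
      Torus.vectorL2Sq (w t) ≤ Torus.vectorL2Sq (w (tStart j)) := by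
  have hF : Torus.IsSmoothSpaceTimeOn (Ico 0 1) P.field := cascadeFieldSmooth P hδ₀ hd
  have hfield : Torus.IsSmoothSpaceTimeOn (Icc (tStart j) (tStart j + tHalf j)) P.field :=
    hF.mono fun s hs => ⟨(tStart_nonneg j).trans hs.1, lt_of_le_of_lt hs.2 (tStart_add_tHalf_lt_one j)⟩
  have hWs : Torus.IsSmoothSpaceTimeOn (Icc (tStart j) (tStart j + tHalf j))
      (fun τ (y : UnitAddTorus (Fin 2)) => h τ (Torus.repr y 1) • EuclideanSpace.single (0 : Fin 2) (1 : ℝ)) :=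
    isSmoothSpaceTimeOn_parallelShear hh hper
  have hqs : Torus.IsSmoothSpaceTimeOn (Icc (tStart j) (tStart j + tHalf j))
      (fun (_ : ℝ) (_ : UnitAddTorus (Fin 2)) => (0 : ℝ)) :=
    Torus.isSmoothSpaceTimeOn_const (Torus.isSmooth_const (0 : ℝ)) _
  have hWdiv : ∀ s ∈ Icc (tStart j) (tStart j + tHalf j),
      Torus.IsDivFree (fun y : UnitAddTorus (Fin 2) => h s (Torus.repr y 1) • EuclideanSpace.single (0 : Fin 2) (1 : ℝ)) :=
    fun s hs => isDivFree_parallelShear (k := 1) (m := 0) (by decide) (hper s hs)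
  have heq : w t = fun y => h t (Torus.repr y 1) • EuclideanSpace.single (0 : Fin 2) (1 : ℝ) :=
    Torus.linearisedNS_unique hν hfield (fun s hs => P.isDivFree_field_of_mem_H hs) hw hq hwdiv hlin hWs hqs
      hWdiv (linearisedNS_parallel_H P hδ₀ hd hh hper heat) h0 ht
  refine ⟨heq, ?_⟩
  rw [heq, h0]
  exact vectorL2Sq_parallel_H_le P hδ₀ hd hν hh hper heat ht

/-! ## The V half-slot -/

/-- On the V half-slot of phase `j` the cascade field is the shear `x ↦ (rateV_j(t) U_j(x₁)) e₂`. -/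
theorem field_eq_parallel_V (P : CascadeParams) {j : ℕ} {t : ℝ}
    (ht : t ∈ Icc (tStart j + tHalf j) (tStart (j + 1))) :
    P.field t = fun y => (P.rateV j t * P.U j (Torus.repr y 0)) • EuclideanSpace.single (1 : Fin 2) (1 : ℝ) := by
  funext y
  rw [P.field_eq_of_mem_V ht y]
  ext i
  fin_cases i <;> simp

/-- **Parallel heat profiles solve the linearised equations on the V half-slot**: the vertical parallel
field `W(t, x) = h(t, x₁) e₂` for a heat profile `h` on `[tStart j + tHalf j, tStart (j+1)]`. -/
theorem linearisedNS_parallel_V (P : CascadeParams) (hδ₀ : 0 < P.δ₀) (hd : 0 < P.d) {j : ℕ} {ν : ℝ}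
    {h : ℝ → ℝ → ℝ}
    (hh : ContDiffOn ℝ ∞ (Function.uncurry h) (Icc (tStart j + tHalf j) (tStart (j + 1)) ×ˢ univ))
    (hper : ∀ t ∈ Icc (tStart j + tHalf j) (tStart (j + 1)), Function.Periodic (h t) 1)
    (heat : ∀ t ∈ Icc (tStart j + tHalf j) (tStart (j + 1)), ∀ y,
      derivWithin (fun τ => h τ y) (Icc (tStart j + tHalf j) (tStart (j + 1))) t =
        ν * deriv (deriv (h t)) y) :
    ∀ t ∈ Icc (tStart j + tHalf j) (tStart (j + 1)), ∀ x,
      Torus.timeDerivWithin (Icc (tStart j + tHalf j) (tStart (j + 1)))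
          (fun τ (y : UnitAddTorus (Fin 2)) => h τ (Torus.repr y 0) • EuclideanSpace.single (1 : Fin 2) (1 : ℝ)) t x +
        Torus.convect (P.field t) (fun y => h t (Torus.repr y 0) • EuclideanSpace.single (1 : Fin 2) (1 : ℝ)) x +
        Torus.convect (fun y => h t (Torus.repr y 0) • EuclideanSpace.single (1 : Fin 2) (1 : ℝ)) (P.field t) x =
      ν • Torus.laplacian (fun y => h t (Torus.repr y 0) • EuclideanSpace.single (1 : Fin 2) (1 : ℝ)) x -
        Torus.gradient (fun _ : UnitAddTorus (Fin 2) => (0 : ℝ)) x := by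
  have hlt : tStart j + tHalf j < tStart (j + 1) := by rw [tStart_succ]; linarith [tHalf_pos j]
  exact linearisedNS_parallelShear (k := 0) (m := 1) (by decide) (uniqueDiffOn_Icc hlt) (u := P.field)
    (c := fun t y => P.rateV j t * P.U j y) (fun _ ht => field_eq_parallel_V P ht)
    (fun t _ y => by simp only [P.U_periodic j y])
    (fun _ _ => contDiff_const.mul (P.contDiff_U (P.δ_pos hδ₀ hd j))) hh hper heat

/-- **Parallel heat profiles are not amplified by the V pulse** (`ν ≥ 0`):
`‖W(t)‖²_{L²} ≤ ‖W(tStart j + tHalf j)‖²_{L²}` on the V half-slot for `W(t) = h(t, x₁) e₂`. -/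
theorem vectorL2Sq_parallel_V_le (P : CascadeParams) (hδ₀ : 0 < P.δ₀) (hd : 0 < P.d) {j : ℕ}
    {ν : ℝ} (hν : 0 ≤ ν) {h : ℝ → ℝ → ℝ}
    (hh : ContDiffOn ℝ ∞ (Function.uncurry h) (Icc (tStart j + tHalf j) (tStart (j + 1)) ×ˢ univ))
    (hper : ∀ t ∈ Icc (tStart j + tHalf j) (tStart (j + 1)), Function.Periodic (h t) 1)
    (heat : ∀ t ∈ Icc (tStart j + tHalf j) (tStart (j + 1)), ∀ y,
      derivWithin (fun τ => h τ y) (Icc (tStart j + tHalf j) (tStart (j + 1))) t =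
        ν * deriv (deriv (h t)) y)
    {t : ℝ} (ht : t ∈ Icc (tStart j + tHalf j) (tStart (j + 1))) :
    Torus.vectorL2Sq (fun y : UnitAddTorus (Fin 2) => h t (Torus.repr y 0) • EuclideanSpace.single (1 : Fin 2) (1 : ℝ)) ≤
      Torus.vectorL2Sq (fun y : UnitAddTorus (Fin 2) =>
        h (tStart j + tHalf j) (Torus.repr y 0) • EuclideanSpace.single (1 : Fin 2) (1 : ℝ)) := by
  have hlt : tStart j + tHalf j < tStart (j + 1) := by rw [tStart_succ]; linarith [tHalf_pos j]
  have hF : Torus.IsSmoothSpaceTimeOn (Ico 0 1) P.field := cascadeFieldSmooth P hδ₀ hd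
  have hfield : Torus.IsSmoothSpaceTimeOn (Icc (tStart j + tHalf j) (tStart (j + 1))) P.field :=
    hF.mono fun s hs =>
      ⟨by linarith [tStart_nonneg j, tHalf_pos j, hs.1], lt_of_le_of_lt hs.2 (tStart_lt_one (j + 1))⟩
  exact vectorL2Sq_parallelShear_le (k := 0) (m := 1) (by decide) hlt hν hfield
    (fun s hs => P.isDivFree_field_of_mem_V hs) (c := fun t y => P.rateV j t * P.U j y)
    (fun _ hs => field_eq_parallel_V P hs) (fun t _ y => by simp only [P.U_periodic j y])
    (fun _ _ => contDiff_const.mul (P.contDiff_U (P.δ_pos hδ₀ hd j))) hh hper heat ht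

/-- **The classical parallel half-pulse rung, V half.** Every classical linearised solution `(w, q)` on
the V half-slot of phase `j` whose datum is a vertical parallel profile `w(tStart j + tHalf j) =
h(tStart j + tHalf j, x₁) e₂` for a heat profile `h` on the slot (`ν ≥ 0`) is the parallel heat field,
`w(t) = h(t, x₁) e₂`, hence `‖w(t)‖²_{L²} ≤ ‖w(tStart j + tHalf j)‖²_{L²}`. -/
theorem parallel_V_unique (P : CascadeParams) (hδ₀ : 0 < P.δ₀) (hd : 0 < P.d) {j : ℕ} {ν : ℝ}
    (hν : 0 ≤ ν) {h : ℝ → ℝ → ℝ}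
    (hh : ContDiffOn ℝ ∞ (Function.uncurry h) (Icc (tStart j + tHalf j) (tStart (j + 1)) ×ˢ univ))
    (hper : ∀ t ∈ Icc (tStart j + tHalf j) (tStart (j + 1)), Function.Periodic (h t) 1)
    (heat : ∀ t ∈ Icc (tStart j + tHalf j) (tStart (j + 1)), ∀ y,
      derivWithin (fun τ => h τ y) (Icc (tStart j + tHalf j) (tStart (j + 1))) t =
        ν * deriv (deriv (h t)) y)
    {w : ℝ → UnitAddTorus (Fin 2) → EuclideanSpace ℝ (Fin 2)} {q : ℝ → UnitAddTorus (Fin 2) → ℝ}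
    (hw : Torus.IsSmoothSpaceTimeOn (Icc (tStart j + tHalf j) (tStart (j + 1))) w)
    (hq : Torus.IsSmoothSpaceTimeOn (Icc (tStart j + tHalf j) (tStart (j + 1))) q)
    (hwdiv : ∀ t ∈ Icc (tStart j + tHalf j) (tStart (j + 1)), Torus.IsDivFree (w t))
    (hlin : ∀ t ∈ Icc (tStart j + tHalf j) (tStart (j + 1)), ∀ x,
      Torus.timeDerivWithin (Icc (tStart j + tHalf j) (tStart (j + 1))) w t x +
        Torus.convect (P.field t) (w t) x + Torus.convect (w t) (P.field t) x =
          ν • Torus.laplacian (w t) x - Torus.gradient (q t) x)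
    (h0 : w (tStart j + tHalf j) =
      fun y => h (tStart j + tHalf j) (Torus.repr y 0) • EuclideanSpace.single (1 : Fin 2) (1 : ℝ))
    {t : ℝ} (ht : t ∈ Icc (tStart j + tHalf j) (tStart (j + 1))) :
    w t = (fun y => h t (Torus.repr y 0) • EuclideanSpace.single (1 : Fin 2) (1 : ℝ)) ∧
      Torus.vectorL2Sq (w t) ≤ Torus.vectorL2Sq (w (tStart j + tHalf j)) := by
  have hF : Torus.IsSmoothSpaceTimeOn (Ico 0 1) P.field := cascadeFieldSmooth P hδ₀ hd
  have hfield : Torus.IsSmoothSpaceTimeOn (Icc (tStart j + tHalf j) (tStart (j + 1))) P.field :=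
    hF.mono fun s hs =>
      ⟨by linarith [tStart_nonneg j, tHalf_pos j, hs.1], lt_of_le_of_lt hs.2 (tStart_lt_one (j + 1))⟩
  have hWs : Torus.IsSmoothSpaceTimeOn (Icc (tStart j + tHalf j) (tStart (j + 1)))
      (fun τ (y : UnitAddTorus (Fin 2)) => h τ (Torus.repr y 0) • EuclideanSpace.single (1 : Fin 2) (1 : ℝ)) :=
    isSmoothSpaceTimeOn_parallelShear hh hper
  have hqs : Torus.IsSmoothSpaceTimeOn (Icc (tStart j + tHalf j) (tStart (j + 1)))
      (fun (_ : ℝ) (_ : UnitAddTorus (Fin 2)) => (0 : ℝ)) :=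
    Torus.isSmoothSpaceTimeOn_const (Torus.isSmooth_const (0 : ℝ)) _
  have hWdiv : ∀ s ∈ Icc (tStart j + tHalf j) (tStart (j + 1)),
      Torus.IsDivFree (fun y : UnitAddTorus (Fin 2) => h s (Torus.repr y 0) • EuclideanSpace.single (1 : Fin 2) (1 : ℝ)) :=
    fun s hs => isDivFree_parallelShear (k := 0) (m := 1) (by decide) (hper s hs)
  have heq : w t = fun y => h t (Torus.repr y 0) • EuclideanSpace.single (1 : Fin 2) (1 : ℝ) :=
    Torus.linearisedNS_unique hν hfield (fun s hs => P.isDivFree_field_of_mem_V hs) hw hq hwdiv hlin hWs hqs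
      hWdiv (linearisedNS_parallel_V P hδ₀ hd hh hper heat) h0 ht
  refine ⟨heq, ?_⟩
  rw [heq, h0]
  exact vectorL2Sq_parallel_V_le P hδ₀ hd hν hh hper heat ht

end Summit.AnomalousDissipation.AnomalousDissipation.Theorems.SawtoothPulseCascade.K2Classical

end
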